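import Literature.MathematicalPhysics.QuantumFieldTheory.Balaban1983to89.B13JointWalkExpansion

/-!
# `Balaban1983to89.B13DomainKernelWalks` — [Balaban1985BackgroundPropagators] Thm 3.10 p. 416 (3.107)–(3.108) at walk
length `|ω| ≤ 1`, AT PRINT'S LEVEL OF LOCALITY: one-step families of OPERATORS LOCALISED IN DOMAINS `X ∈ 𝒟` of bounded
diameter (the terms `R_α(X)` of (3.107)), with s-monomials ([Balaban1988RG2Cluster] (1.11) p. 5, p. 13), ARE
`JointWalkExpansion`s with constants INDEPENDENT OF THE TORUS

statement-level skeleton of published theorems with citation tags; proofs where landed; nothing here is a claim about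
the Yang–Mills mass gap

CITATION HEADER.  [B9] = T. Bałaban, CMP **99** (1985) 389–434, Thm 3.10 p. 416: *"operator G has the expansion
G = Σ_ω R₀(X₀)R_{α₁}(X₁)·…·R_{αₙ}(Xₙ), (3.107) the sum is over walks ω = ((0,X₀),(α₁,X₁),…,(αₙ,Xₙ)) … A term in this
expansion, corresponding to a walk ω, depends on configuration U restricted to X̃₀⁵ ∪ … ∪ X̃ₙ⁵, satisfies the inequality …
e^{−½δ₀d(ω,y,y′)} … The constant O(1) depends on d and L only."*; (3.93) p. 410: *"d(ω,y,y′) = inf_{(y₁,…,yₙ)}(d(y,y₁) + ⋯ +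
d(yₙ,y′)), the infimum is taken over all sequences (y₁,…,yₙ) of points yᵢ ∈ □ᵢ ∈ 𝔅"*; [B6] = CMP **96** (1984) Lemma 2.1
(2.61) p. 234; [II] = CMP **116** (1988) (1.11) p. 5, p. 13, p. 15.

WHAT THIS FILE PROVES (cell `pub-balaban-gaps`, row (D4) NODE O, seat g1-p2 gen 4; g1-plan-1 `ROUTES-PLAN-1` §2 note 22
rung R5 «domain-localised one-step OPERATOR families», the FIRST missing lemma of the rung after the site-pair base case
`B13LocalKernelWalks`).  `DomainTerms`: finitely many one-step terms `b`, each an OPERATOR-VALUED coefficient `u ↦ F_b(u)`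
(rows `p`, columns `n`) SUPPORTED IN `X_b × X_b` for a located DOMAIN `X_b` (a finite set of torus sites of ℓ¹-diameter
`≤ r`, anchored at `anchor b ∈ X_b`), with entries complex-differentiable and `≤ λ` on the `R`-ball, times the s-monomial
`∏_{j∈J_b} σ_j` (`|J_b| ≤ m_J`); σ-carrying terms have domains MEETING the σ-region `X`; at most `n_D` terms per anchor
(`IsDomainLocal`).  `jointWalkExpansion_domainLocal`: `K(σ,u) = Σ_b T_b(σ,u)` is a `JointWalkExpansion` with σ-carrying
sub-family `{J_b ≠ ∅}`, amplitudes `A = λe^{κ₁m_J}e^{2ρr}`, the one-point walk distance (3.93) THROUGH `X_b ∩ X` (when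
non-empty, else through `X_b`) — it dominates `d₁` and passes through `X` EXACTLY for σ-carrying terms —, any `ρ ≥ 0`, drop
`ε`, rates `κ + μ ≤ ρ − ε`, constant `K̄ = A·e^{μr}·n_D·c_μ` (`c_μ` the (2.61) constant at rate `μ`; on every one-scale torus
`c₀(1,μ)^ν`, `B13LocalKernelWalks.rowSum_torus`) — NO DEPENDENCE ON `Nf`.  `domBy_dist`, `walkMajorants_domainLocal`.
HONEST FRAMING: an elementary MODEL-level lemma (finite sums, the triangle inequality, one row sum); the data of print's
walks at ONE scale without the multi-scale structure (block averaging, covariant operators, the k-dependence of 𝒟_k);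
NOTHING about Bałaban's `Γ_k(Z₀,σ,𝐔,𝐉)`, `Δ^{(k)}`, `C^{(k)}` is asserted — whether THEY admit such data with k-uniform
constants is row (D4)'s open OBJECT-level content (GAPS G-B9-10, NODE O.2 (v)); (D4) is NOT discharged (instance 0∕1);
NOT B12 Thm 2, NOT `BetaPertH`, NOT continuum ∕ ℝ⁴, NOT infinite volume, NOT mass gap, NOT Clay.
-/

noncomputable section

namespace Literature.MathematicalPhysics.QuantumFieldTheory.Balaban1983to89.B13DomainKernelWalks

open Metric Set Finset
open Literature.MathematicalPhysics.QuantumFieldTheory.Balaban1983to89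
open Literature.MathematicalPhysics.QuantumFieldTheory.Balaban1983to89.B9SectDWalk (Through MajSumLe DomBy)
open Literature.MathematicalPhysics.QuantumFieldTheory.Balaban1983to89.B9Thm34Ext (toB6)
open Literature.MathematicalPhysics.QuantumFieldTheory.Balaban1983to89.B9Thm37GlueTorus
  (torusGeom tdist1 tdist1_nonneg tdist1_triangle tdist1_self tdist1_comm)
open Literature.MathematicalPhysics.QuantumFieldTheory.Balaban1983to89.TreeLengthTorus (TPt)
open Literature.MathematicalPhysics.QuantumFieldTheory.Balaban1983to89.B5TorusCover (UT)
open Literature.MathematicalPhysics.QuantumFieldTheory.Balaban1983to89.B11SectG (RowSum)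
open Literature.MathematicalPhysics.QuantumFieldTheory.Balaban1983to89.B13JointWalkExpansion
  (JointWalkExpansion WalkMajorants)

variable {d N' : ℕ} {ν : ℕ} {Nf : Fin ν → ℕ} [∀ i, NeZero (Nf i)]
variable {p n : Type}
variable {E : Type*} [NormedAddCommGroup E] [NormedSpace ℂ E]

/-! ## §1. The datum: finitely many domain-localised operator terms with s-monomials -/

/-- **DOMAIN TERM DATUM** (Type-valued record, nothing asserted): a finite index `B` of one-step terms; term `b` has a
located DOMAIN `dom b` (finite set of torus sites) with an `anchor b`, a finite set `J b` of decoupling parameters (the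
s-monomial of (1.11)), and an OPERATOR-VALUED coefficient `op b : E → Matrix p n ℂ` (print: `R_α(X)`, a function of the
configuration restricted to `X̃⁵`). [cite: Balaban1985BackgroundPropagators, (3.107) p.416; Balaban1988RG2Cluster, (1.11) p.5, p.13] -/
structure DomainTerms (d N' ν : ℕ) (Nf : Fin ν → ℕ) [∀ i, NeZero (Nf i)] (p n : Type)
    (E : Type*) [NormedAddCommGroup E] [NormedSpace ℂ E] where
  B : Type
  [instFintype : Fintype B]
  dom : B → Finset (UT Nf)
  anchor : B → UT Nf
  J : B → Finset (TPt d N')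
  op : B → E → Matrix p n ℂ

namespace DomainTerms

/-- The term index of a datum is a finite type (the bundled instance, exposed as an instance). [folklore] -/
instance instFintypeB (L : DomainTerms d N' ν Nf p n E) : Fintype L.B := L.instFintype

variable (L : DomainTerms d N' ν Nf p n E)

/-- The term `T_b(σ,u) = (∏_{j ∈ J_b} σ_j)·F_b(u)`. [cite: Balaban1988RG2Cluster, (1.11) p.5] -/
def term (b : L.B) : (TPt d N' → ℂ) → E → Matrix p n ℂ :=
  fun σ u => (∏ j ∈ L.J b, σ j) • L.op b u

/-- The kernel family `K(σ,u) = Σ_b T_b(σ,u)`. [cite: Balaban1985BackgroundPropagators, (3.107) p.416] -/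
def kernel : (TPt d N' → ℂ) → E → Matrix p n ℂ :=
  fun σ u => ∑ b, L.term b σ u

/-- The σ-CARRYING sub-family (`m ≥ 1` in (1.11)). [cite: Balaban1988RG2Cluster, (1.11) p.5] -/
def sigmaCarrying : Set L.B := {b | (L.J b).Nonempty}

/-- The set the one-point walk distance of term `b` passes through: `X_b ∩ X` when the domain meets the σ-region, else `X_b`.
[cite: Balaban1985BackgroundPropagators, (3.93) p.410] -/
def via (X : Finset (UT Nf)) (b : L.B) : Finset (UT Nf) :=
  if (L.dom b ∩ X).Nonempty then L.dom b ∩ X else L.dom b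

/-- The ONE-POINT walk distance (3.93) of term `b`: `D_b(a,a′) = min_{z ∈ via} (d₁(a,z) + d₁(z,a′))` (and `d₁` itself on an
empty domain). [cite: Balaban1985BackgroundPropagators, (3.93) p.410] -/
def dist (X : Finset (UT Nf)) (b : L.B) (a a' : UT Nf) : ℝ :=
  if h : (L.via X b).Nonempty then (L.via X b).inf' h (fun z => tdist1 Nf a z + tdist1 Nf z a') else tdist1 Nf a a'

/-- **DOMAIN LOCALITY of the datum** (Prop-valued): anchors in their domains; coefficients SUPPORTED in `X_b × X_b`, entries
complex-differentiable and `≤ λ` on the `R`-ball ([II] p. 15); domain diameter `≤ r`; `|J_b| ≤ m_J`; σ-carrying terms have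
domains MEETING `X` (p. 13); at most `n_D` terms per anchor. [cite: Balaban1985BackgroundPropagators, Thm 3.10 p.416; Balaban1988RG2Cluster, (1.11) p.5, p.13, p.15] -/
structure IsDomainLocal (c : B13.Consts) (locp : p → UT Nf) (locn : n → UT Nf) (X : Finset (UT Nf))
    (R lam r : ℝ) (mJ nD : ℕ) : Prop where
  hanchor : ∀ b, L.anchor b ∈ L.dom b
  hsupp : ∀ b u i j, L.op b u i j ≠ 0 → locp i ∈ L.dom b ∧ locn j ∈ L.dom b
  han : ∀ b i j, DifferentiableOn ℂ (fun u => L.op b u i j) (ball (0 : E) R)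
  hbd : ∀ b, ∀ u ∈ ball (0 : E) R, ∀ i j, ‖L.op b u i j‖ ≤ lam
  hdiam : ∀ b, ∀ z ∈ L.dom b, ∀ z' ∈ L.dom b, tdist1 Nf z z' ≤ r
  hJ : ∀ b, (L.J b).card ≤ mJ
  hX : ∀ b, (L.J b).Nonempty → (L.dom b ∩ X).Nonempty
  hmult : ∀ z : UT Nf, (Finset.univ.filter fun b => L.anchor b = z).card ≤ nD

/-! ## §2. Elementary facts: entries, the via-set, the one-point distance -/

/-- Entry formula of a (1.11)-shape term. [cite: Balaban1988RG2Cluster, (1.11) p.5] -/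
theorem term_apply (b : L.B) (σ : TPt d N' → ℂ) (u : E) (i : p) (j : n) :
    L.term b σ u i j = (∏ j ∈ L.J b, σ j) * L.op b u i j := by
  simp [term, Matrix.smul_apply, smul_eq_mul]

/-- Entry formula of the (3.107)-shape kernel. [cite: Balaban1985BackgroundPropagators, (3.107) p.416] -/
theorem kernel_apply (σ : TPt d N' → ℂ) (u : E) (i : p) (j : n) :
    L.kernel σ u i j = ∑ b, L.term b σ u i j := by
  simp [kernel, Matrix.sum_apply]

/-- The via-set is inside the domain. [cite: Balaban1985BackgroundPropagators, (3.93) p.410] -/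
theorem via_subset (X : Finset (UT Nf)) (b : L.B) : L.via X b ⊆ L.dom b := by
  unfold via
  split_ifs
  · exact Finset.inter_subset_left
  · exact le_rfl

/-- When the domain meets the σ-region, the via-set is inside the σ-region. [cite: Balaban1985BackgroundPropagators, (3.93) p.410] -/
theorem via_subset_X {X : Finset (UT Nf)} {b : L.B} (h : (L.dom b ∩ X).Nonempty) : L.via X b ⊆ X := by
  unfold via
  rw [if_pos h]
  exact Finset.inter_subset_right

/-- A non-empty domain has a non-empty via-set. [cite: Balaban1985BackgroundPropagators, (3.93) p.410] -/
theorem via_nonempty (X : Finset (UT Nf)) {b : L.B} (h : (L.dom b).Nonempty) : (L.via X b).Nonempty := by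
  unfold via
  split_ifs with h'
  · exact h'
  · exact h

/-- The one-point distance is below every passage value through a point of the via-set. [cite: Balaban1985BackgroundPropagators, (3.93) p.410] -/
theorem dist_le (X : Finset (UT Nf)) (b : L.B) {z : UT Nf} (hz : z ∈ L.via X b) (a a' : UT Nf) :
    L.dist X b a a' ≤ tdist1 Nf a z + tdist1 Nf z a' := by
  unfold dist
  rw [dif_pos ⟨z, hz⟩]
  exact Finset.inf'_le (fun z => tdist1 Nf a z + tdist1 Nf z a') hz

/-- The one-point distance is attained at a point of the via-set (non-empty case). [cite: Balaban1985BackgroundPropagators, (3.93) p.410] -/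
theorem exists_dist_eq (X : Finset (UT Nf)) (b : L.B) (h : (L.via X b).Nonempty) (a a' : UT Nf) :
    ∃ z ∈ L.via X b, L.dist X b a a' = tdist1 Nf a z + tdist1 Nf z a' := by
  obtain ⟨z, hz, e⟩ := Finset.exists_mem_eq_inf' h (fun z => tdist1 Nf a z + tdist1 Nf z a')
  exact ⟨z, hz, by unfold dist; rw [dif_pos h, e]⟩

/-- The one-point distance dominates the torus distance ((2.54)). [cite: Balaban1984PropagatorsII, (2.54) p.233] -/
theorem tdist1_le_dist (X : Finset (UT Nf)) (b : L.B) (a a' : UT Nf) : tdist1 Nf a a' ≤ L.dist X b a a' := by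
  by_cases h : (L.via X b).Nonempty
  · obtain ⟨z, -, e⟩ := L.exists_dist_eq X b h a a'
    rw [e]; exact tdist1_triangle _ _ _
  · unfold dist; rw [dif_neg h]

/-- The one-point distance is non-negative. [cite: Balaban1985BackgroundPropagators, (3.93) p.410] -/
theorem dist_nonneg (X : Finset (UT Nf)) (b : L.B) (a a' : UT Nf) : 0 ≤ L.dist X b a a' :=
  (tdist1_nonneg a a').trans (L.tdist1_le_dist X b a a')

/-- `DomBy` for the one-point distance in the torus geometry of the walk objects (the `hdom` input of the product ∕ Neumann
steps). [cite: Balaban1984PropagatorsII, (2.54) p.233] -/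
theorem domBy_dist (X : Finset (UT Nf)) (b : L.B) : DomBy (toB6 (torusGeom Nf 0 0 0) 0 True) (L.dist X b) :=
  fun a a' => L.tdist1_le_dist X b a a'

/-- The one-point distance of a term whose domain MEETS `X` passes THROUGH `X` (exactly). [cite: Balaban1985BackgroundPropagators, (3.93) p.410] -/
theorem through_dist {X : Finset (UT Nf)} {b : L.B} (h : (L.dom b ∩ X).Nonempty) :
    Through (toB6 (torusGeom Nf 0 0 0) 0 True) (L.dist X b) (↑X : Set (UT Nf)) := by
  intro a a'
  have hv : (L.via X b).Nonempty := by unfold via; rw [if_pos h]; exact h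
  obtain ⟨z, hz, e⟩ := L.exists_dist_eq X b hv a a'
  exact ⟨z, Finset.mem_coe.2 (L.via_subset_X h hz), by rw [e]; exact le_rfl⟩

/-! ## §3. The per-term bound (3.108) for a domain-localised term -/

/-- The s-monomial on the polydisc (`κ₁ ≥ 0`, `|J| ≤ m_J`) is bounded by `e^{κ₁·m_J}`. [cite: Balaban1988RG2Cluster, (1.11) p.5] -/
theorem norm_monomial_le {c : B13.Consts} (hκ₁ : 0 ≤ c.κ₁) {J : Finset (TPt d N')} {mJ : ℕ} (hJ : J.card ≤ mJ)
    (σ : TPt d N' → ℂ) (hσ : ∀ j, ‖σ j‖ ≤ Real.exp c.κ₁) :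
    ‖∏ j ∈ J, σ j‖ ≤ Real.exp (c.κ₁ * mJ) := by
  rw [norm_prod]
  calc ∏ j ∈ J, ‖σ j‖ ≤ ∏ _j ∈ J, Real.exp c.κ₁ := Finset.prod_le_prod (fun j _ => norm_nonneg _) fun j _ => hσ j
    _ = Real.exp c.κ₁ ^ J.card := Finset.prod_const _
    _ ≤ Real.exp c.κ₁ ^ mJ := pow_le_pow_right₀ (Real.one_le_exp hκ₁) hJ
    _ = Real.exp (c.κ₁ * mJ) := by rw [← Real.exp_nat_mul, mul_comm]

variable {L}
variable {c : B13.Consts} {locp : p → UT Nf} {locn : n → UT Nf} {X : Finset (UT Nf)} {R lam r : ℝ} {mJ nD : ℕ}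

/-- On the support of a term the one-point distance is at most twice the domain diameter. [cite: Balaban1985BackgroundPropagators, (3.93) p.410] -/
theorem dist_le_two_mul_of_mem (hL : L.IsDomainLocal c locp locn X R lam r mJ nD) (b : L.B) {a a' : UT Nf}
    (ha : a ∈ L.dom b) (ha' : a' ∈ L.dom b) : L.dist X b a a' ≤ 2 * r := by
  have hv : (L.via X b).Nonempty := L.via_nonempty X ⟨a, ha⟩
  obtain ⟨z, hz⟩ := hv
  have hzd : z ∈ L.dom b := L.via_subset X b hz
  have h1 := hL.hdiam b a ha z hzd
  have h2 := hL.hdiam b z hzd a' ha'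
  linarith [L.dist_le X b hz a a']

/-- **THE PER-TERM BOUND (3.108) ∕ (1.11) of a domain-localised term**, uniformly on polydisc × ball: `‖T_b(σ,u)(i,j)‖ ≤
λe^{κ₁m_J}e^{2ρr}·e^{−ρD_b(loc i, loc j)}` (`ρ ≥ 0`). [cite: Balaban1985BackgroundPropagators, (3.108) p.416; Balaban1988RG2Cluster, (1.11) p.5] -/
theorem norm_term_le (hL : L.IsDomainLocal c locp locn X R lam r mJ nD) (hκ₁ : 0 ≤ c.κ₁) (hlam : 0 ≤ lam) {ρ : ℝ}
    (hρ : 0 ≤ ρ) (b : L.B) (σ : TPt d N' → ℂ) (hσ : ∀ j, ‖σ j‖ ≤ Real.exp c.κ₁) (u : E) (hu : u ∈ ball (0 : E) R)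
    (i : p) (j : n) :
    ‖L.term b σ u i j‖ ≤ (lam * Real.exp (c.κ₁ * mJ) * Real.exp (2 * ρ * r)) * Real.exp (-(ρ * L.dist X b (locp i) (locn j))) := by
  by_cases hM : L.op b u i j = 0
  · rw [term_apply, hM, mul_zero, norm_zero]; positivity
  · obtain ⟨hi, hj⟩ := hL.hsupp b u i j hM
    have hD := dist_le_two_mul_of_mem hL b hi hj
    rw [term_apply, norm_mul]
    have h1 := norm_monomial_le hκ₁ (hL.hJ b) σ hσ
    have h2 := hL.hbd b u hu i j
    have h4 : 1 ≤ Real.exp (2 * ρ * r) * Real.exp (-(ρ * L.dist X b (locp i) (locn j))) := by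
      rw [← Real.exp_add]
      exact Real.one_le_exp (by nlinarith [mul_nonneg hρ (sub_nonneg.2 hD)])
    calc ‖∏ j ∈ L.J b, σ j‖ * ‖L.op b u i j‖ ≤ Real.exp (c.κ₁ * mJ) * lam :=
          mul_le_mul h1 h2 (norm_nonneg _) (Real.exp_nonneg _)
      _ = (lam * Real.exp (c.κ₁ * mJ)) * 1 := by ring
      _ ≤ (lam * Real.exp (c.κ₁ * mJ)) * (Real.exp (2 * ρ * r) * Real.exp (-(ρ * L.dist X b (locp i) (locn j)))) :=
          mul_le_mul_of_nonneg_left h4 (mul_nonneg hlam (Real.exp_nonneg _))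
      _ = (lam * Real.exp (c.κ₁ * mJ) * Real.exp (2 * ρ * r)) * Real.exp (-(ρ * L.dist X b (locp i) (locn j))) := by
          ring

/-! ## §4. Summability without walk counting: one row sum over the anchors -/

/-- Fibre multiplicity over anchors. [folklore] -/
private theorem sum_anchor_le_mul_sum (hmult : ∀ z : UT Nf, (Finset.univ.filter fun b => L.anchor b = z).card ≤ nD)
    (f : UT Nf → ℝ) (hf : ∀ z, 0 ≤ f z) : ∑ b, f (L.anchor b) ≤ nD * ∑ z : UT Nf, f z := by
  classical
  rw [← Finset.sum_fiberwise_of_maps_to (g := L.anchor) (t := Finset.univ) (fun b _ => Finset.mem_univ _), Finset.mul_sum]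
  refine Finset.sum_le_sum fun z _ => ?_
  rw [Finset.sum_congr rfl fun b hb => by rw [(Finset.mem_filter.1 hb).2], Finset.sum_const, nsmul_eq_mul]
  exact mul_le_mul_of_nonneg_right (by exact_mod_cast hmult z) (hf z)

/-- **`MajSumLe` FOR THE DOMAIN-LOCALISED FAMILY, TORUS-UNIFORMLY**: `A ≥ 0`, `κ, μ ≥ 0`, `κ + μ ≤ ρ′`, (2.61) at rate `μ`
(constant `c_μ`) ⟹ partial sums of `A·e^{−ρ′D_b(a,a′)}` are `≤ (A·e^{μr}·n_D·c_μ)e^{−κd₁(a,a′)}`: the one-point distance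
pays `κd₁(a,a′)` AND `μ(d₁(a,anchor_b) − r)`, anchors summed by (2.61) ([B9] p. 410 *"We use part of the exponentials to
control the sum over yᵢ's"*). [cite: Balaban1985BackgroundPropagators, (3.93)–(3.94) p.410, (3.108) p.416; Balaban1984PropagatorsII, (2.61) p.234] -/
theorem majSumLe_domainLocal (hL : L.IsDomainLocal c locp locn X R lam r mJ nD)
    {A ρ' κ μ cμ : ℝ} (hA : 0 ≤ A) (hκ : 0 ≤ κ) (hμ : 0 ≤ μ) (hwin : κ + μ ≤ ρ')
    (hrow : RowSum (toB6 (torusGeom Nf 0 0 0) 0 True) μ cμ) :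
    MajSumLe (g := toB6 (torusGeom Nf 0 0 0) 0 True)
      (fun b a a' => A * Real.exp (-(ρ' * L.dist X b a a')))
      (fun a a' => (A * Real.exp (μ * r) * (nD * cμ)) * Real.exp (-(κ * tdist1 Nf a a'))) := by
  intro S a a'
  have hterm : ∀ b, A * Real.exp (-(ρ' * L.dist X b a a')) ≤
      (A * Real.exp (μ * r) * Real.exp (-(κ * tdist1 Nf a a'))) * Real.exp (-(μ * tdist1 Nf a (L.anchor b))) := by
    intro b
    have hv : (L.via X b).Nonempty := L.via_nonempty X ⟨L.anchor b, hL.hanchor b⟩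
    obtain ⟨z, hz, e⟩ := L.exists_dist_eq X b hv a a'
    have hzd : z ∈ L.dom b := L.via_subset X b hz
    have h1 : tdist1 Nf a a' ≤ L.dist X b a a' := L.tdist1_le_dist X b a a'
    have h2 : tdist1 Nf a (L.anchor b) ≤ L.dist X b a a' + r := by
      have := tdist1_triangle (N := Nf) a z (L.anchor b)
      have := hL.hdiam b z hzd (L.anchor b) (hL.hanchor b)
      have := tdist1_nonneg (N := Nf) z a'
      linarith
    have h3 := L.dist_nonneg X b a a'
    rw [mul_assoc, mul_assoc, ← Real.exp_add, ← Real.exp_add]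
    refine mul_le_mul_of_nonneg_left (Real.exp_le_exp.2 ?_) hA
    nlinarith [mul_nonneg hκ (sub_nonneg.2 h1), mul_nonneg hμ (sub_nonneg.2 h2), mul_nonneg (sub_nonneg.2 hwin) h3]
  have hrow' : ∑ z : UT Nf, Real.exp (-(μ * tdist1 Nf a z)) ≤ cμ := hrow a
  have h0 : 0 ≤ A * Real.exp (μ * r) * Real.exp (-(κ * tdist1 Nf a a')) := by positivity
  calc ∑ b ∈ S, A * Real.exp (-(ρ' * L.dist X b a a'))
      ≤ ∑ b ∈ S, (A * Real.exp (μ * r) * Real.exp (-(κ * tdist1 Nf a a'))) * Real.exp (-(μ * tdist1 Nf a (L.anchor b))) :=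
        Finset.sum_le_sum fun b _ => hterm b
    _ ≤ ∑ b, (A * Real.exp (μ * r) * Real.exp (-(κ * tdist1 Nf a a'))) * Real.exp (-(μ * tdist1 Nf a (L.anchor b))) :=
        Finset.sum_le_sum_of_subset_of_nonneg (Finset.subset_univ S) fun b _ _ => mul_nonneg h0 (Real.exp_nonneg _)
    _ = (A * Real.exp (μ * r) * Real.exp (-(κ * tdist1 Nf a a'))) * ∑ b, Real.exp (-(μ * tdist1 Nf a (L.anchor b))) := by
        rw [Finset.mul_sum]
    _ ≤ (A * Real.exp (μ * r) * Real.exp (-(κ * tdist1 Nf a a'))) * (nD * ∑ z : UT Nf, Real.exp (-(μ * tdist1 Nf a z))) :=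
        mul_le_mul_of_nonneg_left (sum_anchor_le_mul_sum hL.hmult (fun z => Real.exp (-(μ * tdist1 Nf a z)))
          fun z => Real.exp_nonneg _) h0
    _ ≤ (A * Real.exp (μ * r) * Real.exp (-(κ * tdist1 Nf a a'))) * (nD * cμ) :=
        mul_le_mul_of_nonneg_left (mul_le_mul_of_nonneg_left hrow' (Nat.cast_nonneg nD)) h0
    _ = (A * Real.exp (μ * r) * (nD * cμ)) * Real.exp (-(κ * tdist1 Nf a a')) := by ring

/-! ## §5. The theorem: a domain-localised datum IS a joint walk expansion, torus-uniformly -/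

/-- **DOMAIN-LOCALISED ONE-STEP OPERATOR FAMILIES ARE JOINT WALK EXPANSIONS WITH TORUS-UNIFORM CONSTANTS** (print's level of
locality for one step of (3.107)).  `IsDomainLocal` (`λ, κ₁ ≥ 0`), any `ρ ≥ 0`, drop `ε`, `κ, μ ≥ 0` with `κ + μ ≤ ρ − ε`,
(2.61) at rate `μ` (constant `c_μ`) ⟹ `K = Σ_b T_b` is a `JointWalkExpansion` on the `R`-ball: terms `T_b`, σ-carrying
sub-family `{J_b ≠ ∅}`, amplitudes `A = λe^{κ₁m_J}e^{2ρr}`, one-point distances through `X_b ∩ X` (resp. `X_b`), rate `ρ`,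
constant `K̄ = A·e^{μr}·n_D·c_μ` — every letter independent of the torus and of the index types; `through` holds EXACTLY for
σ-carrying terms (no range loss in the σ-mechanism). [cite: Balaban1985BackgroundPropagators, Thm 3.10 (3.107)–(3.108) p.416, (3.93) p.410; Balaban1988RG2Cluster, (1.11) p.5, p.13, p.15; Balaban1984PropagatorsII, (2.61) p.234] -/
theorem jointWalkExpansion_domainLocal (hL : L.IsDomainLocal c locp locn X R lam r mJ nD) (hκ₁ : 0 ≤ c.κ₁)
    (hlam : 0 ≤ lam) {ρ ε κ μ cμ : ℝ} (hρ : 0 ≤ ρ) (hκ : 0 ≤ κ) (hμ : 0 ≤ μ) (hwin : κ + μ ≤ ρ - ε)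
    (hrow : RowSum (toB6 (torusGeom Nf 0 0 0) 0 True) μ cμ) :
    JointWalkExpansion c locp locn L.kernel X R ε κ
      ((lam * Real.exp (c.κ₁ * mJ) * Real.exp (2 * ρ * r)) * Real.exp (μ * r) * (nD * cμ))
      L.term L.sigmaCarrying (fun _ => lam * Real.exp (c.κ₁ * mJ) * Real.exp (2 * ρ * r)) (L.dist X) ρ where
  hasSum σ hσ u hu i j := by
    rw [kernel_apply]
    exact hasSum_fintype _
  termAnalytic b σ hσ i j := by
    have h : (fun u => L.term b σ u i j) = fun u => (∏ j ∈ L.J b, σ j) * L.op b u i j :=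
      funext fun u => L.term_apply b σ u i j
    rw [h]
    exact (differentiableOn_const _).mul (hL.han b i j)
  maj b σ hσ u hu i j := norm_term_le hL hκ₁ hlam hρ b σ hσ u hu i j
  majSum := majSumLe_domainLocal hL (by positivity) hκ hμ hwin hrow
  indep b hb σ hσ := by
    have hJ : L.J b = ∅ := Finset.not_nonempty_iff_eq_empty.1 hb
    simp [term, hJ]
  through b hb := L.through_dist (hL.hX b hb)
  A_nonneg _ := by positivity
  D_nonneg b a a' := L.dist_nonneg X b a a'

/-- **The covariance-slot triple** (`WalkMajorants`) for a domain-localised datum (`ε = 0`). [cite: Balaban1985BackgroundPropagators, (3.108) p.416] -/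
theorem walkMajorants_domainLocal (hL : L.IsDomainLocal c locp locn X R lam r mJ nD) (hκ₁ : 0 ≤ c.κ₁) (hlam : 0 ≤ lam)
    {ρ κ μ cμ : ℝ} (hρ : 0 ≤ ρ) (hκ : 0 ≤ κ) (hμ : 0 ≤ μ) (hwin : κ + μ ≤ ρ)
    (hrow : RowSum (toB6 (torusGeom Nf 0 0 0) 0 True) μ cμ) :
    WalkMajorants c locp locn L.kernel R κ ((lam * Real.exp (c.κ₁ * mJ) * Real.exp (2 * ρ * r)) * Real.exp (μ * r) * (nD * cμ))
      L.term (fun _ => lam * Real.exp (c.κ₁ * mJ) * Real.exp (2 * ρ * r)) (L.dist X) ρ := by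
  have h := jointWalkExpansion_domainLocal hL hκ₁ hlam (ε := 0) hρ hκ hμ (by simpa using hwin) hrow
  exact ⟨h.hasSum, h.maj, by simpa using h.majSum, h.A_nonneg⟩

end DomainTerms

end Literature.MathematicalPhysics.QuantumFieldTheory.Balaban1983to89.B13DomainKernelWalks

end
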